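import Summits.BirchSwinnertonDyer.BirchSwinnertonDyer.Theorems.InertBadSignedBranchesCccOneLawOnTypeIstarZeroOfLowerHalf
import HarnessLib

/-!
# Route `InertBadSignedBranches` (rung K8), crux `CccOneLawOnTypeIstarZero`: the three REGISTERED
# STUBS of the BC3 skeleton read on the halves of `BSD_p` — `stub_etaBranchNonvanishing` and
# `stub_etaValuationUpper` DISCHARGED modulo the route's own support items (+ the published upper
# half), `stub_etaValuationLower` ⟺ `LowerHalfOnType p I₀*`
# (helper toward stmt-BirchSwinnertonDyer-19223; cell bsd-cm, seat bsd-cm-k8i-c2; nothing asserted)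

The planner's birth skeleton of the crux (`Cruxes/CccOneLawOnTypeIstarZero/Lines/birth.lean`,
HOME/bsd-cm-plan/g10/routes/K8/bc, sha16 a7b2ef46af194379) splits C-cc-1 on the signed type
`(p, I₀*)`, `p ≥ 5`, into three stubs under the common binder prefix of the law (good `a_p = 0` twin
datum `(V, C, f, ϖ, L)`, `W(ℚ_p)[p] = 0`, a generator `P` of `p`-divisibility level `n`, a rational
value `q` of `#Ш_an(W)`):
* NV  `stub_etaBranchNonvanishing` : `coeff₁ L ≠ 0`;
* U   `stub_etaValuationUpper`     : `v_p(coeff₁ L) ≤ 2n + ord_p(q·Tam(W)/#tors²)`;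
* L   `stub_etaValuationLower`     : `2n + ord_p(q·Tam(W)/#tors²) ≤ v_p(coeff₁ L)`;
and `CccOneLawOnTypeIstarZero_of` = ⟨NV, le_antisymm U L⟩. THIS FILE reads each stub against the
tree (the stub BODIES are spelled out; no helper `def` is introduced):

* §1 PER DATUM (PROVED arithmetic, the one-sided halves of x1b's converse bookkeeping
  `valuation_coeff_one_eq_of_bsdp_of_exactControl`): with the exact control value (C3_η)
  `ord_p #Sel_str + n + ord_p(Tam/#tors²) = v_p(coeff₁ L)` and the DISCHARGED index
  `ord_p #Sel_str = n + ord_p #Ш[p^∞]` (`StrictSha.strictSelmerIndexAt_holds`), the inequality U at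
  the datum ⟺ the UPPER half `MissingUpperBoundAt W p` (`ord_p #Ш ≤ ord_p #Ш_an`), and L at the
  datum ⟺ the LOWER half `MissingLowerBoundAt W p`.
* §2 ON THE TYPE, modulo the route's OWN support items `PrintReadingsInert` (19226) and
  `PublishedFactsInert` (19227) — (C3_η) being discharged from the readings by x1b's
  `LevelBridge.quadraticBranchOddStrictExactControlOfPlusMCAt_of_readings`, the datum SUPPLIED by
  x1b's `pairData_elim` (Mazur's period datum `periodRatio_of_mazur`):
  - `stubNonvanishingAt_of_printReadings` — stub NV holds (inert g11's
    `CccOneLowerHalf.coeff_one_ne_zero_of_exactReading`, lifted to the type);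
  - `stubUpperAt_iff_upperHalfOnType` — stub U at `p` ⟺ (∀ `W` of the type with `r_an = 1`,
    `MissingUpperBoundAt W p`); hence `stubUpperAt_of_facts_of_seven_lt`: **stub U HOLDS at every
    `p ≥ 11`** from the eleven published facts of x1b's every-curve Kolyvagin half
    (`X12.missingUpperBoundAt_of_classX12_of_cmInert`);
  - `stubLowerAt_iff_lowerHalfOnType` — **stub L at `p` ⟺ `X12.O10.LowerHalfOnType p I₀*`**, the
    main-conjecture half of `BSD_p` on the type (STEP L); `cccOneLawAt_iff_stubLowerAt_of_seven_lt`: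
    at `p ≥ 11` the `p`-slice of the crux ⟺ stub L alone; and the skeleton's composition re-read:
    `cccOneLawOnTypeIstarZero_of_stubLower_of_upperHalf_five_seven`.
So, modulo the route's support items and published facts, the skeleton's open content is EXACTLY ONE
stub, L = the lower half on the type; NV and U carry nothing beyond print at `p ≥ 11` (at `p ∈ {5, 7}`
U is the upper half with its Manin datum).

HONEST LABEL: every statement is CONDITIONAL on displayed hypotheses (the route's typed support
items, published named facts); no `def`, no named fact minted, nothing booked; the crux 19223 and
O10 stay OPEN at class level. What this is NOT: not a proof of any stub outright (the registered
stubs are unconditional); not a proof of the lower half.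
[cite: Kobayashi2003, §4 (p. 8), Thm. 7.4 (p. 13), Thm. 9.3 (p. 26)] [cite: Miller2011LMS, §1 and Def. 1.1]
[cite: GreenbergLNM1716, §2 (pp. 62–63) and §4 Lemma 4.2 (p. 102)] [cite: MatarNekovar2019, Thm. 0.3 and §0.11]
-/

set_option autoImplicit false
set_option linter.dupNamespace false

noncomputable section

open scoped Classical MatrixGroups ModularForm NumberField

open CongruenceSubgroup Field WeierstrassCurve NumberField IsDedekindDomain
open Literature.NumberTheory.EllipticCurves
open Literature.NumberTheory.EllipticCurves.ModularForms
open Literature.NumberTheory.EllipticCurves.Kobayashi2003 hiding IsQuadraticBranchMinusLFunction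
open Literature.NumberTheory.EllipticCurves.Rank1Residual
open Literature.NumberTheory.EllipticCurves.Rank1Residual.Typed
open Literature.NumberTheory.GaloisRepresentations Literature.NumberTheory.GaloisCohomology
open Summit.BirchSwinnertonDyer.Rank1Residual
open Summit.BirchSwinnertonDyer.Rank1Residual.Additive
open Summit.BirchSwinnertonDyer.Rank1Residual.X12.O10
open Summit.BirchSwinnertonDyer.BirchSwinnertonDyer.Theses.InertBadSignedBranches

namespace Summit.BirchSwinnertonDyer.BirchSwinnertonDyer.Theorems.CccOneStubHalves

variable (W : WeierstrassCurve ℚ) [W.IsElliptic] [W.IsGloballyMinimal] (p : ℕ) [hp : Fact p.Prime]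

/-! ## §1 Per datum: the one-sided inequalities of the law are the halves of `BSD_p` -/

section PerDatum

variable {V : WeierstrassCurve ℚ} [V.IsElliptic] [V.IsGloballyMinimal] {C : VariableChange ℚ}
  {N : ℕ} [NeZero N] {f : CuspForm (Gamma0 N) 2} {ϖ : ℚ} {L : IwasawaAlgebra p}
  {P : W.toAffine.Point} {n : ℕ}

/-- **The exact-control value at a datum, in `#Ш` currency (PROVED arithmetic):** with (C3_η) at
`(W, p)` and the DISCHARGED index `#Sel_str = pⁿ·#Ш[p^∞]`, at every datum of the law with
`coeff₁ L ≠ 0` and `Ш(W)` finite,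
`v_p(coeff₁ L) = 2n + ord_p #Ш(W) + ord_p(Tam(W)/#W(ℚ)_tors²)`. CONDITIONAL on (C3_η); nothing booked.
[cite: Kobayashi2003, Thm. 9.3 (p. 26)] [cite: GreenbergLNM1716, §2 (pp. 62–63)] -/
theorem valuation_coeff_one_eq_of_exactControl [Finite W.sha]
    (h3 : QuadraticBranchOddStrictExactControlOfPlusMCAt W p)
    (hp5 : 5 ≤ p) (hC : C • W.quadraticTwist ((-1) ^ (p / 2) * p) = V)
    (hgood : V.HasGoodReductionAtPrime p) (hap : V.frobeniusTrace p = 0)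
    (h1 : QuadraticBranchPlusMainConjectureAt V p) (hf : IsNewformOf V f)
    (hϖ : if Even (p / 2) then (ϖ : ℝ) * V.realPeriodRat = plusPeriod f
        else (ϖ : ℝ) * V.imaginaryPeriodRat = minusPeriod f)
    (hL : IsQuadraticBranchMinusLFunction f p ϖ L)
    (htors : ∀ Q : (W.baseChange ℚ_[p]).toAffine.Point, p • Q = 0 → Q = 0)
    (hP : ¬ IsOfFinAddOrder P)
    (hgen : ∀ R : W.toAffine.Point, ∃ (k : ℤ) (T : W.toAffine.Point),
      IsOfFinAddOrder T ∧ R = k • P + T)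
    (hdiv : ∃ Q : (W.baseChange ℚ_[p]).toAffine.Point, p ^ n • Q = W.toPadicPoint p P)
    (hndiv : ∀ Q : (W.baseChange ℚ_[p]).toAffine.Point, p ^ (n + 1) • Q ≠ W.toPadicPoint p P)
    (hr : W.analyticRank = 1) (hne : PowerSeries.coeff 1 L ≠ 0) :
    ((PowerSeries.coeff 1 L : ℤ_[p]) : ℚ_[p]).valuation =
      2 * (n : ℤ) + padicValNat p W.shaOrder +
        padicValRat p ((W.tamagawaProduct : ℚ) / (W.torsionOrder : ℚ) ^ 2) := by
  obtain ⟨-, hv3⟩ := h3 V C hp5 hC hgood hap hr h1 hf ϖ hϖ L hL htors P n hP hgen hdiv hndiv hne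
  have hI := (StrictSha.strictSelmerIndexAt_holds W p).padicValNat_card_eq hP hgen htors hdiv hndiv
  have hSha : padicValNat p (Nat.card (AddCommGroup.primaryComponent W.sha p)) =
      padicValNat p W.shaOrder := by
    rw [WeierstrassCurve.shaOrder, padicValNat_card_addPrimaryComponent]
  rw [hI, Nat.cast_add, hSha] at hv3
  rw [← hv3]
  ring

/-- **U at a datum FROM the upper half** (PROVED arithmetic): `MissingUpperBoundAt W p`
(`ord_p #Ш(W) ≤ ord_p #Ш_an(W)`) and (C3_η) give `v_p(coeff₁ L) ≤ 2n + ord_p(q·Tam/#tors²)` for every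
rational `q` with `#Ш_an(W) = q` (`q ≠ 0` by `hmod`). CONDITIONAL on (C3_η); nothing booked.
[cite: Miller2011LMS, §1 and Def. 1.1] [cite: Kobayashi2003, Thm. 9.3 (p. 26)] -/
theorem valuation_coeff_one_le_of_missingUpperBoundAt_of_exactControl (hmod : hasEntireLFunction_rat)
    [Finite W.sha] (hU : MissingUpperBoundAt W p)
    (h3 : QuadraticBranchOddStrictExactControlOfPlusMCAt W p)
    (hp5 : 5 ≤ p) (hC : C • W.quadraticTwist ((-1) ^ (p / 2) * p) = V)
    (hgood : V.HasGoodReductionAtPrime p) (hap : V.frobeniusTrace p = 0)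
    (h1 : QuadraticBranchPlusMainConjectureAt V p) (hf : IsNewformOf V f)
    (hϖ : if Even (p / 2) then (ϖ : ℝ) * V.realPeriodRat = plusPeriod f
        else (ϖ : ℝ) * V.imaginaryPeriodRat = minusPeriod f)
    (hL : IsQuadraticBranchMinusLFunction f p ϖ L)
    (htors : ∀ Q : (W.baseChange ℚ_[p]).toAffine.Point, p • Q = 0 → Q = 0)
    (hP : ¬ IsOfFinAddOrder P)
    (hgen : ∀ R : W.toAffine.Point, ∃ (k : ℤ) (T : W.toAffine.Point),
      IsOfFinAddOrder T ∧ R = k • P + T)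
    (hdiv : ∃ Q : (W.baseChange ℚ_[p]).toAffine.Point, p ^ n • Q = W.toPadicPoint p P)
    (hndiv : ∀ Q : (W.baseChange ℚ_[p]).toAffine.Point, p ^ (n + 1) • Q ≠ W.toPadicPoint p P)
    (hr : W.analyticRank = 1) (hne : PowerSeries.coeff 1 L ≠ 0)
    (q : ℚ) (hq : shaAn W = (q : ℂ)) :
    ((PowerSeries.coeff 1 L : ℤ_[p]) : ℚ_[p]).valuation ≤
      2 * (n : ℤ) + padicValRat p (q * W.tamagawaProduct / (W.torsionOrder : ℚ) ^ 2) := by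
  obtain ⟨q₀, hq₀, hle⟩ := hU
  have hqs : q = q₀ := by
    have : ((q : ℂ)) = (q₀ : ℂ) := by rw [← hq, hq₀]
    exact_mod_cast this
  subst hqs
  have hq0 : q ≠ 0 := by
    rintro rfl
    exact AdditivePotMult.shaAn_ne_zero W hmod (by rw [hq, Rat.cast_zero])
  have hc : (W.tamagawaProduct : ℚ) ≠ 0 := by exact_mod_cast W.tamagawaProduct_pos_holds.ne'
  have ht : (W.torsionOrder : ℚ) ≠ 0 := by exact_mod_cast W.torsionOrder_pos_holds.ne'
  have hct : (W.tamagawaProduct : ℚ) / (W.torsionOrder : ℚ) ^ 2 ≠ 0 :=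
    div_ne_zero hc (pow_ne_zero 2 ht)
  have hsplit : padicValRat p (q * W.tamagawaProduct / (W.torsionOrder : ℚ) ^ 2) =
      padicValRat p q + padicValRat p ((W.tamagawaProduct : ℚ) / (W.torsionOrder : ℚ) ^ 2) := by
    rw [mul_div_assoc, padicValRat.mul hq0 hct]
  rw [hsplit, valuation_coeff_one_eq_of_exactControl W p h3 hp5 hC hgood hap h1 hf hϖ hL htors hP
    hgen hdiv hndiv hr hne]
  linarith

/-- **L at a datum FROM the lower half** (PROVED arithmetic): `MissingLowerBoundAt W p`
(`ord_p #Ш_an(W) ≤ ord_p #Ш(W)`) and (C3_η) give `2n + ord_p(q·Tam/#tors²) ≤ v_p(coeff₁ L)` for every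
rational `q` with `#Ш_an(W) = q`. CONDITIONAL on (C3_η); nothing booked.
[cite: Miller2011LMS, §1 and Def. 1.1] [cite: Kobayashi2003, Thm. 9.3 (p. 26)] -/
theorem le_valuation_coeff_one_of_missingLowerBoundAt_of_exactControl (hmod : hasEntireLFunction_rat)
    [Finite W.sha] (hlo : MissingLowerBoundAt W p)
    (h3 : QuadraticBranchOddStrictExactControlOfPlusMCAt W p)
    (hp5 : 5 ≤ p) (hC : C • W.quadraticTwist ((-1) ^ (p / 2) * p) = V)
    (hgood : V.HasGoodReductionAtPrime p) (hap : V.frobeniusTrace p = 0)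
    (h1 : QuadraticBranchPlusMainConjectureAt V p) (hf : IsNewformOf V f)
    (hϖ : if Even (p / 2) then (ϖ : ℝ) * V.realPeriodRat = plusPeriod f
        else (ϖ : ℝ) * V.imaginaryPeriodRat = minusPeriod f)
    (hL : IsQuadraticBranchMinusLFunction f p ϖ L)
    (htors : ∀ Q : (W.baseChange ℚ_[p]).toAffine.Point, p • Q = 0 → Q = 0)
    (hP : ¬ IsOfFinAddOrder P)
    (hgen : ∀ R : W.toAffine.Point, ∃ (k : ℤ) (T : W.toAffine.Point),
      IsOfFinAddOrder T ∧ R = k • P + T)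
    (hdiv : ∃ Q : (W.baseChange ℚ_[p]).toAffine.Point, p ^ n • Q = W.toPadicPoint p P)
    (hndiv : ∀ Q : (W.baseChange ℚ_[p]).toAffine.Point, p ^ (n + 1) • Q ≠ W.toPadicPoint p P)
    (hr : W.analyticRank = 1) (hne : PowerSeries.coeff 1 L ≠ 0)
    (q : ℚ) (hq : shaAn W = (q : ℂ)) :
    2 * (n : ℤ) + padicValRat p (q * W.tamagawaProduct / (W.torsionOrder : ℚ) ^ 2) ≤
      ((PowerSeries.coeff 1 L : ℤ_[p]) : ℚ_[p]).valuation := by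
  obtain ⟨q₀, hq₀, hle⟩ := hlo
  have hqs : q = q₀ := by
    have : ((q : ℂ)) = (q₀ : ℂ) := by rw [← hq, hq₀]
    exact_mod_cast this
  subst hqs
  have hq0 : q ≠ 0 := by
    rintro rfl
    exact AdditivePotMult.shaAn_ne_zero W hmod (by rw [hq, Rat.cast_zero])
  have hc : (W.tamagawaProduct : ℚ) ≠ 0 := by exact_mod_cast W.tamagawaProduct_pos_holds.ne'
  have ht : (W.torsionOrder : ℚ) ≠ 0 := by exact_mod_cast W.torsionOrder_pos_holds.ne'
  have hct : (W.tamagawaProduct : ℚ) / (W.torsionOrder : ℚ) ^ 2 ≠ 0 :=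
    div_ne_zero hc (pow_ne_zero 2 ht)
  have hsplit : padicValRat p (q * W.tamagawaProduct / (W.torsionOrder : ℚ) ^ 2) =
      padicValRat p q + padicValRat p ((W.tamagawaProduct : ℚ) / (W.torsionOrder : ℚ) ^ 2) := by
    rw [mul_div_assoc, padicValRat.mul hq0 hct]
  rw [hsplit, valuation_coeff_one_eq_of_exactControl W p h3 hp5 hC hgood hap h1 hf hϖ hL htors hP
    hgen hdiv hndiv hr hne]
  linarith

/-- **The upper half FROM U at ONE datum** (PROVED arithmetic): if at some datum of the law with
`coeff₁ L ≠ 0` the inequality `v_p(coeff₁ L) ≤ 2n + ord_p(q·Tam/#tors²)` holds for a rational value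
`q` of `#Ш_an(W)`, then (C3_η) gives `MissingUpperBoundAt W p`. CONDITIONAL on (C3_η); nothing booked.
[cite: Miller2011LMS, §1 and Def. 1.1] [cite: Kobayashi2003, Thm. 9.3 (p. 26)] -/
theorem missingUpperBoundAt_of_valuation_coeff_one_le_of_exactControl (hmod : hasEntireLFunction_rat)
    [Finite W.sha] (h3 : QuadraticBranchOddStrictExactControlOfPlusMCAt W p)
    (hp5 : 5 ≤ p) (hC : C • W.quadraticTwist ((-1) ^ (p / 2) * p) = V)
    (hgood : V.HasGoodReductionAtPrime p) (hap : V.frobeniusTrace p = 0)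
    (h1 : QuadraticBranchPlusMainConjectureAt V p) (hf : IsNewformOf V f)
    (hϖ : if Even (p / 2) then (ϖ : ℝ) * V.realPeriodRat = plusPeriod f
        else (ϖ : ℝ) * V.imaginaryPeriodRat = minusPeriod f)
    (hL : IsQuadraticBranchMinusLFunction f p ϖ L)
    (htors : ∀ Q : (W.baseChange ℚ_[p]).toAffine.Point, p • Q = 0 → Q = 0)
    (hP : ¬ IsOfFinAddOrder P)
    (hgen : ∀ R : W.toAffine.Point, ∃ (k : ℤ) (T : W.toAffine.Point),
      IsOfFinAddOrder T ∧ R = k • P + T)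
    (hdiv : ∃ Q : (W.baseChange ℚ_[p]).toAffine.Point, p ^ n • Q = W.toPadicPoint p P)
    (hndiv : ∀ Q : (W.baseChange ℚ_[p]).toAffine.Point, p ^ (n + 1) • Q ≠ W.toPadicPoint p P)
    (hr : W.analyticRank = 1) (hne : PowerSeries.coeff 1 L ≠ 0)
    {q : ℚ} (hq : shaAn W = (q : ℂ))
    (hle : ((PowerSeries.coeff 1 L : ℤ_[p]) : ℚ_[p]).valuation ≤
      2 * (n : ℤ) + padicValRat p (q * W.tamagawaProduct / (W.torsionOrder : ℚ) ^ 2)) :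
    MissingUpperBoundAt W p := by
  refine ⟨q, hq, ?_⟩
  have hq0 : q ≠ 0 := by
    rintro rfl
    exact AdditivePotMult.shaAn_ne_zero W hmod (by rw [hq, Rat.cast_zero])
  have hc : (W.tamagawaProduct : ℚ) ≠ 0 := by exact_mod_cast W.tamagawaProduct_pos_holds.ne'
  have ht : (W.torsionOrder : ℚ) ≠ 0 := by exact_mod_cast W.torsionOrder_pos_holds.ne'
  have hct : (W.tamagawaProduct : ℚ) / (W.torsionOrder : ℚ) ^ 2 ≠ 0 :=
    div_ne_zero hc (pow_ne_zero 2 ht)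
  have hsplit : padicValRat p (q * W.tamagawaProduct / (W.torsionOrder : ℚ) ^ 2) =
      padicValRat p q + padicValRat p ((W.tamagawaProduct : ℚ) / (W.torsionOrder : ℚ) ^ 2) := by
    rw [mul_div_assoc, padicValRat.mul hq0 hct]
  rw [hsplit, valuation_coeff_one_eq_of_exactControl W p h3 hp5 hC hgood hap h1 hf hϖ hL htors hP
    hgen hdiv hndiv hr hne] at hle
  linarith

/-- **The lower half FROM L at ONE datum** (PROVED arithmetic): if at some datum of the law with
`coeff₁ L ≠ 0` the inequality `2n + ord_p(q·Tam/#tors²) ≤ v_p(coeff₁ L)` holds for a rational value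
`q` of `#Ш_an(W)`, then (C3_η) gives `MissingLowerBoundAt W p`. CONDITIONAL on (C3_η); nothing booked.
[cite: Miller2011LMS, §1 and Def. 1.1] [cite: Kobayashi2003, Thm. 9.3 (p. 26)] -/
theorem missingLowerBoundAt_of_le_valuation_coeff_one_of_exactControl (hmod : hasEntireLFunction_rat)
    [Finite W.sha] (h3 : QuadraticBranchOddStrictExactControlOfPlusMCAt W p)
    (hp5 : 5 ≤ p) (hC : C • W.quadraticTwist ((-1) ^ (p / 2) * p) = V)
    (hgood : V.HasGoodReductionAtPrime p) (hap : V.frobeniusTrace p = 0)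
    (h1 : QuadraticBranchPlusMainConjectureAt V p) (hf : IsNewformOf V f)
    (hϖ : if Even (p / 2) then (ϖ : ℝ) * V.realPeriodRat = plusPeriod f
        else (ϖ : ℝ) * V.imaginaryPeriodRat = minusPeriod f)
    (hL : IsQuadraticBranchMinusLFunction f p ϖ L)
    (htors : ∀ Q : (W.baseChange ℚ_[p]).toAffine.Point, p • Q = 0 → Q = 0)
    (hP : ¬ IsOfFinAddOrder P)
    (hgen : ∀ R : W.toAffine.Point, ∃ (k : ℤ) (T : W.toAffine.Point),
      IsOfFinAddOrder T ∧ R = k • P + T)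
    (hdiv : ∃ Q : (W.baseChange ℚ_[p]).toAffine.Point, p ^ n • Q = W.toPadicPoint p P)
    (hndiv : ∀ Q : (W.baseChange ℚ_[p]).toAffine.Point, p ^ (n + 1) • Q ≠ W.toPadicPoint p P)
    (hr : W.analyticRank = 1) (hne : PowerSeries.coeff 1 L ≠ 0)
    {q : ℚ} (hq : shaAn W = (q : ℂ))
    (hle : 2 * (n : ℤ) + padicValRat p (q * W.tamagawaProduct / (W.torsionOrder : ℚ) ^ 2) ≤
      ((PowerSeries.coeff 1 L : ℤ_[p]) : ℚ_[p]).valuation) :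
    MissingLowerBoundAt W p := by
  refine ⟨q, hq, ?_⟩
  have hq0 : q ≠ 0 := by
    rintro rfl
    exact AdditivePotMult.shaAn_ne_zero W hmod (by rw [hq, Rat.cast_zero])
  have hc : (W.tamagawaProduct : ℚ) ≠ 0 := by exact_mod_cast W.tamagawaProduct_pos_holds.ne'
  have ht : (W.torsionOrder : ℚ) ≠ 0 := by exact_mod_cast W.torsionOrder_pos_holds.ne'
  have hct : (W.tamagawaProduct : ℚ) / (W.torsionOrder : ℚ) ^ 2 ≠ 0 :=
    div_ne_zero hc (pow_ne_zero 2 ht)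
  have hsplit : padicValRat p (q * W.tamagawaProduct / (W.torsionOrder : ℚ) ^ 2) =
      padicValRat p q + padicValRat p ((W.tamagawaProduct : ℚ) / (W.torsionOrder : ℚ) ^ 2) := by
    rw [mul_div_assoc, padicValRat.mul hq0 hct]
  rw [hsplit, valuation_coeff_one_eq_of_exactControl W p h3 hp5 hC hgood hap h1 hf hϖ hL htors hP
    hgen hdiv hndiv hr hne] at hle
  linarith

end PerDatum

end Summit.BirchSwinnertonDyer.BirchSwinnertonDyer.Theorems.CccOneStubHalves

end
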